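import Summits.CriticalPhenomena.Ising3DConformalLimit.Theorems.HyperoctahedralRPExistsScaleCovariantLimitDecimationPathLipschitzGivesCrux
import HarnessLib

/-!
# What the composition of line `decimation-homotopy-rate` actually CONSUMES: mesh rates of the critical n.n. model

Crux `Summit.CriticalPhenomena.Ising3DConformalLimit.Theses.HyperoctahedralRP.ExistsScaleCovariantLimit` (item
stmt-CriticalPhenomena-1981), line `decimation-homotopy-rate` (lead `prover-line-stmt-CriticalPhenomena-1981-c8-0`). The line's
registered engine conjecture `PathLipschitz p` quantifies over ALL pairs of points of the critical curve `J = J_χ(K)`,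
`K, K' ∈ [0, β_c]`; the landed composition (`meshRate`, `Theorems/…DecimationPathLipschitzGivesCrux.lean`, p130196) uses it at
ONE pair only, the two endpoints `(K, J) = (β_c, 0)` and `(0, β_c)`, whose finite-volume pinned zooms ARE (stubs E, B, C landed)
the pinned zoom `Z(m; z) = ⟨∏ᵢσ_{m zᵢ}⟩_{β_c} · ⟨σ₀σ_{m e₀}⟩_{β_c}^{-n/2}` (`latticeZoom`) of the critical nearest-neighbour model at
the two integer meshes `m = pL` and `m = L`. This file records, sorry-free, the resulting MINIMAL sufficient inputs — statements
about `criticalCorr 3` alone, no two-coupling model, no curve: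

* `latticeZoom_sub_le_of_finZoom` — limit passage: a bound on the endpoint difference of finite-volume pinned zooms, valid for
  all large volumes, bounds `|Z(pL; z) − Z(L; z)|`;
* `hierarchy_of_summable_meshDifferences` — if `k ↦ |Z(p^{k+1}; z) − Z(p^k; z)|` is summable at every injective integer
  configuration, the pinned zoom converges along the meshes `p^{-k}` (completeness of `ℝ`; the weakest quantitative form);
* `hierarchy_of_meshRate` — the power-rate form `|Z(pL; z) − Z(L; z)| ≤ B · L^{-θ}` (what `PathLipschitz p` yields) implies it;
* `ExistsScaleCovariantLimit_of_meshRates` (registered sub-goal) — **mesh rates at `p = 2` and `p = 3` give the crux**;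
  `ExistsScaleCovariantLimit_of_summableMeshDifferences` — summable dyadic and triadic mesh differences give the crux;
  `ExistsScaleCovariantLimit_of_endpointRates` — the finite-volume endpoint form (PathLipschitz restricted to the endpoint pair);
  `twoPointDoubling_of_meshRate2` — the dyadic mesh rate ALONE gives item 6150 (hence 5955, 4658).

Reading for planners / the disprover: the crux-level content of the line is EXACTLY "the p-adic Cauchy differences of the pinned
critical zoom are summable for p = 2 and p = 3" — a quantitative strengthening of the dead line `Sketch`'s residue S2' ∧ S3'
(convergence) and strictly weaker than `PathLipschitz 2 ∧ PathLipschitz 3`; the homotopy along the critical curve is the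
heuristic REASON (corrections to scaling `O(L^{-ω})`, `ω ≈ 0.83`), not a consumed input. Nothing here is asserted unconditionally
beyond these implications.
-/

noncomputable section

open Filter Topology
open scoped BigOperators
open Literature.Probability.LatticeModels
open Summit.CriticalPhenomena.Ising3DConformalLimit.MoebiusLimitExistsOnlyInteraction (rhoPin)
open Summit.CriticalPhenomena.Ising3DConformalLimit.Theses
open Classical

namespace Summit.CriticalPhenomena.Ising3DConformalLimit.Cruxes.ExistsScaleCovariantLimit.DecimationHomotopyRate

/-- **Limit passage at the endpoint pair.** If, in all large volumes `N`, the finite-volume pinned sublattice zooms of the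
two-coupling model at the endpoints `(β_c, 0)` and `(0, β_c)` differ by at most `b`, then the pinned zooms of the critical
n.n. model at the meshes `pL` and `L` differ by at most `b` (E p130071, F = `freeBoxLimit_holds`, volumes `N = pM → ∞`). [folklore] -/
theorem latticeZoom_sub_le_of_finZoom {p : ℕ} (hp : 2 ≤ p) (n : ℕ) (z : Fin n → Site 3) (L : ℕ) {b : ℝ} {N₀ : ℕ}
    (h : ∀ N : ℕ, N₀ ≤ N →
      |finZoom p N (criticalBeta 3) 0 n L z - finZoom p N 0 (criticalBeta 3) n L z| ≤ b) :
    |latticeZoom n (p * L) z - latticeZoom n L z| ≤ b := by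
  have hE : EndpointIdentity p := stub_endpointIdentity p hp
  have hF : FreeBoxLimit := freeBoxLimit_holds
  have hpos : 0 < p := by omega
  have hsub : Tendsto (fun M : ℕ => p * M) atTop atTop :=
    tendsto_atTop_mono (fun M => Nat.le_mul_of_pos_left M hpos) tendsto_id
  -- (a) the `J = 0` end
  have hA : Tendsto (fun M : ℕ => finZoom p (p * M) (criticalBeta 3) 0 n L z) atTop
      (𝓝 (latticeZoom n (p * L) z)) := by
    have h1 : Tendsto (fun M : ℕ => boxAvg p (p * M) (criticalBeta 3) 0 (axisPair (p * L))) atTop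
        (𝓝 (criticalTwoPoint 3 (Pi.single 0 ((p * L : ℕ) : ℤ)))) := by
      rw [← criticalCorr_axisPair]
      exact ((hF 2 (axisPair (p * L))).comp hsub).congr fun M => (boxAvg_zero_J p (p * M) _ _).symm
    have h2 : Tendsto (fun M : ℕ => boxAvg p (p * M) (criticalBeta 3) 0 (fun i => ((p * L : ℕ) : ℤ) • z i))
        atTop (𝓝 (criticalCorr 3 n (fun i => ((p * L : ℕ) : ℤ) • z i))) :=
      ((hF n _).comp hsub).congr fun M => (boxAvg_zero_J p (p * M) _ _).symm
    exact ((h1.rpow_const (Or.inl (criticalTwoPoint_axis_pos _).ne')).pow n).mul h2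
  -- (b) the `K = 0` end
  have hB : Tendsto (fun M : ℕ => finZoom p (p * M) 0 (criticalBeta 3) n L z) atTop
      (𝓝 (latticeZoom n L z)) := by
    have h1 : Tendsto (fun M : ℕ => boxAvg p (p * M) 0 (criticalBeta 3) (axisPair (p * L))) atTop
        (𝓝 (criticalTwoPoint 3 (Pi.single 0 (L : ℤ)))) := by
      rw [← criticalCorr_axisPair]
      refine (hF 2 (axisPair L)).congr fun M => ?_
      rw [← smul_axisPair p L, hE, Nat.mul_div_cancel_left M hpos]
    have h2 : Tendsto (fun M : ℕ => boxAvg p (p * M) 0 (criticalBeta 3) (fun i => ((p * L : ℕ) : ℤ) • z i))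
        atTop (𝓝 (criticalCorr 3 n (fun i => (L : ℤ) • z i))) := by
      refine (hF n (fun i => (L : ℤ) • z i)).congr fun M => ?_
      rw [← smul_smul_cfg p L z, hE, Nat.mul_div_cancel_left M hpos]
    exact ((h1.rpow_const (Or.inl (criticalTwoPoint_axis_pos _).ne')).pow n).mul h2
  -- (c) pass to the limit along `N = pM ≥ N₀`
  have hev : ∀ᶠ M : ℕ in atTop,
      |finZoom p (p * M) (criticalBeta 3) 0 n L z - finZoom p (p * M) 0 (criticalBeta 3) n L z| ≤ b :=
    eventually_atTop.2 ⟨N₀, fun M hM => h (p * M) (hM.trans (Nat.le_mul_of_pos_left M hpos))⟩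
  exact le_of_tendsto ((hA.sub hB).abs) hev

/-- **Summable mesh differences ⟹ one hierarchy** (the weakest quantitative form): if at every injective integer configuration
the `p`-adic differences `|Z(p^{k+1}; z) − Z(p^k; z)|` are summable in `k`, the pinned zoom of the critical n.n. model converges
along the meshes `p^{-k}` at every non-coincident integer configuration (completeness of `ℝ`). [folklore] -/
theorem hierarchy_of_summable_meshDifferences {p : ℕ}
    (h : ∀ (n : ℕ) (z : Fin n → Site 3), Function.Injective z →
      Summable fun k : ℕ => |latticeZoom n (p ^ (k + 1)) z - latticeZoom n (p ^ k) z|) :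
    ∀ (n : ℕ) (y : Fin n → EuclideanSpace ℝ (Fin 3)), y ∈ NonCoincident 3 n →
      (∀ i j, ∃ z : ℤ, y i j = (z : ℝ)) →
      ∃ Lim : ℝ, Tendsto (fun k : ℕ => rescaledCorrelator (criticalCorr 3) rhoPin n (((p : ℝ) ^ k)⁻¹) y)
        atTop (𝓝 Lim) := by
  intro n y hy hint
  choose z hz using hint
  have hzinj : Function.Injective z := fun i i' h' =>
    hy (PiLp.ext fun j => by rw [hz i j, hz i' j, h'])
  have hdist : ∀ k : ℕ, dist (latticeZoom n (p ^ k) z) (latticeZoom n (p ^ (k + 1)) z) ≤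
      |latticeZoom n (p ^ (k + 1)) z - latticeZoom n (p ^ k) z| := fun k => by
    rw [Real.dist_eq, abs_sub_comm]
  obtain ⟨Lim, hLim⟩ := cauchySeq_tendsto_of_complete
    (cauchySeq_of_dist_le_of_summable _ hdist (h n z hzinj))
  refine ⟨Lim, hLim.congr fun k => ?_⟩
  rw [← rescaledCorrelator_intMesh y z hz (p ^ k), Nat.cast_pow]

/-- **Power mesh rate ⟹ one hierarchy**: `|Z(pL; z) − Z(L; z)| ≤ B · L^{-θ}` (`θ > 0`, all `L ≥ 1`) makes the `p`-adic differences
geometrically summable. [folklore] -/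
theorem hierarchy_of_meshRate {p : ℕ} (hp : 2 ≤ p)
    (h : ∀ (n : ℕ) (z : Fin n → Site 3), Function.Injective z → ∃ θ : ℝ, 0 < θ ∧ ∃ B : ℝ, ∀ L : ℕ, 1 ≤ L →
      |latticeZoom n (p * L) z - latticeZoom n L z| ≤ B * (L : ℝ) ^ (-θ)) :
    ∀ (n : ℕ) (y : Fin n → EuclideanSpace ℝ (Fin 3)), y ∈ NonCoincident 3 n →
      (∀ i j, ∃ z : ℤ, y i j = (z : ℝ)) →
      ∃ Lim : ℝ, Tendsto (fun k : ℕ => rescaledCorrelator (criticalCorr 3) rhoPin n (((p : ℝ) ^ k)⁻¹) y)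
        atTop (𝓝 Lim) := by
  refine hierarchy_of_summable_meshDifferences fun n z hz => ?_
  obtain ⟨θ, hθ, B, hB⟩ := h n z hz
  have hp1 : (1 : ℝ) < p := by exact_mod_cast hp
  have hr : (p : ℝ) ^ (-θ) < 1 := Real.rpow_lt_one_of_one_lt_of_neg hp1 (by linarith)
  have hr0 : 0 ≤ (p : ℝ) ^ (-θ) := Real.rpow_nonneg (Nat.cast_nonneg p) _
  have hle : ∀ k : ℕ, |latticeZoom n (p ^ (k + 1)) z - latticeZoom n (p ^ k) z| ≤ B * ((p : ℝ) ^ (-θ)) ^ k := by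
    intro k
    rw [pow_succ', ← natCast_pow_rpow_neg]
    exact hB (p ^ k) (Nat.one_le_pow k p (by omega))
  refine Summable.of_nonneg_of_le (fun k => abs_nonneg _) hle ?_
  exact (summable_geometric_of_lt_one hr0 hr).mul_left B

/-- **The dyadic mesh rate ALONE ⟹ item 6150 `TwoPointDoubling`** (hence items 5955, 4658 by the landed item maps).
[cite: AizenmanDuminilCopinAnnals2021, arXiv:1912.07973 Remark 5.10] -/
theorem twoPointDoubling_of_meshRate2
    (h2 : ∀ (n : ℕ) (z : Fin n → Site 3), Function.Injective z → ∃ θ : ℝ, 0 < θ ∧ ∃ B : ℝ, ∀ L : ℕ, 1 ≤ L →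
      |latticeZoom n (2 * L) z - latticeZoom n L z| ≤ B * (L : ℝ) ^ (-θ)) :
    MirrorHoelderCompactness.TwoPointDoubling :=
  TwoHierarchies.twoPointDoubling_of_dyadicIntConvergence fun n y hy hint => by
    simpa using hierarchy_of_meshRate (p := 2) le_rfl h2 n y hy hint

/-- **MESH RATES AT THE TWO PRIMES GIVE THE CRUX** (registered sub-goal): power-rate Cauchy differences of the pinned critical zoom
along `L ↦ 2L` and along `L ↦ 3L`, at every injective integer configuration, imply `ExistsScaleCovariantLimit` (two hierarchies
force the filter, `TwoHierarchies.crux_iff_dyadicInt_triadicInt`, p123864). [cite: DuminilCopinICM2022, §8.4 p. 29] -/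
theorem ExistsScaleCovariantLimit_of_meshRates :
    (∀ (n : ℕ) (z : Fin n → Site 3), Function.Injective z → ∃ θ : ℝ, 0 < θ ∧ ∃ B : ℝ, ∀ L : ℕ, 1 ≤ L →
      |latticeZoom n (2 * L) z - latticeZoom n L z| ≤ B * (L : ℝ) ^ (-θ)) →
    (∀ (n : ℕ) (z : Fin n → Site 3), Function.Injective z → ∃ θ : ℝ, 0 < θ ∧ ∃ B : ℝ, ∀ L : ℕ, 1 ≤ L →
      |latticeZoom n (3 * L) z - latticeZoom n L z| ≤ B * (L : ℝ) ^ (-θ)) →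
    Summit.CriticalPhenomena.Ising3DConformalLimit.Theses.HyperoctahedralRP.ExistsScaleCovariantLimit := by
  intro h2 h3
  refine TwoHierarchies.crux_iff_dyadicInt_triadicInt.2 ⟨fun n y hy hint => ?_, fun n y hy hint => ?_⟩
  · simpa using hierarchy_of_meshRate (p := 2) le_rfl h2 n y hy hint
  · simpa using hierarchy_of_meshRate (p := 3) (by norm_num) h3 n y hy hint

/-- **Summable dyadic and triadic mesh differences give the crux** (the weakest quantitative input of this shape).
[cite: DuminilCopinICM2022, §8.4 p. 29] -/
theorem ExistsScaleCovariantLimit_of_summableMeshDifferences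
    (h2 : ∀ (n : ℕ) (z : Fin n → Site 3), Function.Injective z →
      Summable fun k : ℕ => |latticeZoom n (2 ^ (k + 1)) z - latticeZoom n (2 ^ k) z|)
    (h3 : ∀ (n : ℕ) (z : Fin n → Site 3), Function.Injective z →
      Summable fun k : ℕ => |latticeZoom n (3 ^ (k + 1)) z - latticeZoom n (3 ^ k) z|) :
    Summit.CriticalPhenomena.Ising3DConformalLimit.Theses.HyperoctahedralRP.ExistsScaleCovariantLimit := by
  refine TwoHierarchies.crux_iff_dyadicInt_triadicInt.2 ⟨fun n y hy hint => ?_, fun n y hy hint => ?_⟩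
  · simpa using hierarchy_of_summable_meshDifferences (p := 2) h2 n y hy hint
  · simpa using hierarchy_of_summable_meshDifferences (p := 3) h3 n y hy hint

/-- **The finite-volume ENDPOINT form** — `PathLipschitz p` restricted to the single pair of curve points `(β_c, 0)`, `(0, β_c)`
(no `Jcrit`, by C `J_χ(β_c) = 0`, `J_χ(0) = β_c`): endpoint rates at `p = 2` and `p = 3` give the crux. This is exactly what the
skeleton's `meshRate` consumes of `PathLipschitz`. [cite: DuminilCopinICM2022, §8.4 p. 29] -/
theorem ExistsScaleCovariantLimit_of_endpointRates
    (h2 : ∀ (n : ℕ) (z : Fin n → Site 3), Function.Injective z → ∃ θ : ℝ, 0 < θ ∧ ∃ C : ℝ, ∀ L : ℕ, 1 ≤ L →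
      ∃ N₀ : ℕ, ∀ N : ℕ, N₀ ≤ N →
        |finZoom 2 N (criticalBeta 3) 0 n L z - finZoom 2 N 0 (criticalBeta 3) n L z| ≤ C * (L : ℝ) ^ (-θ))
    (h3 : ∀ (n : ℕ) (z : Fin n → Site 3), Function.Injective z → ∃ θ : ℝ, 0 < θ ∧ ∃ C : ℝ, ∀ L : ℕ, 1 ≤ L →
      ∃ N₀ : ℕ, ∀ N : ℕ, N₀ ≤ N →
        |finZoom 3 N (criticalBeta 3) 0 n L z - finZoom 3 N 0 (criticalBeta 3) n L z| ≤ C * (L : ℝ) ^ (-θ)) :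
    Summit.CriticalPhenomena.Ising3DConformalLimit.Theses.HyperoctahedralRP.ExistsScaleCovariantLimit := by
  refine ExistsScaleCovariantLimit_of_meshRates (fun n z hz => ?_) (fun n z hz => ?_)
  · obtain ⟨θ, hθ, C, hC⟩ := h2 n z hz
    refine ⟨θ, hθ, C, fun L hL => ?_⟩
    obtain ⟨N₀, hN₀⟩ := hC L hL
    exact latticeZoom_sub_le_of_finZoom (p := 2) le_rfl n z L hN₀
  · obtain ⟨θ, hθ, C, hC⟩ := h3 n z hz
    refine ⟨θ, hθ, C, fun L hL => ?_⟩
    obtain ⟨N₀, hN₀⟩ := hC L hL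
    exact latticeZoom_sub_le_of_finZoom (p := 3) (by norm_num) n z L hN₀

/-! ## Appendix (lead c8, same cycle): ONE family suffices with summable CONSECUTIVE-mesh differences -/

/-- **Summable consecutive-mesh differences give the crux** (registered sub-goal): if at every injective integer configuration the
differences `|Z(m+1; z) − Z(m; z)|` of the pinned critical zoom at consecutive integer meshes are summable in `m` (e.g.
`≤ B · m^{-1-θ}`, the lattice shadow of corrections to scaling `Z(m;z) = Z*(z) + b(z) m^{-ω} + …`), then the pinned zoom converges
along ALL integer meshes, which is the crux (landed `TwoHierarchies.crux_iff_intMeshConvergence`, p123864: the integer meshes contain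
the dyadic and triadic ones, compactness included). No second prime is needed in this form. [cite: DuminilCopinICM2022, §8.4 p. 29] -/
theorem ExistsScaleCovariantLimit_of_summableIntMeshDifferences :
    (∀ (n : ℕ) (z : Fin n → Site 3), Function.Injective z →
      Summable fun m : ℕ => |latticeZoom n (m + 1) z - latticeZoom n m z|) →
    Summit.CriticalPhenomena.Ising3DConformalLimit.Theses.HyperoctahedralRP.ExistsScaleCovariantLimit := by
  intro h
  refine TwoHierarchies.crux_iff_intMeshConvergence.2 fun n y hy hint => ?_
  choose z hz using hint
  have hzinj : Function.Injective z := fun i i' h' =>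
    hy (PiLp.ext fun j => by rw [hz i j, hz i' j, h'])
  have hdist : ∀ m : ℕ, dist (latticeZoom n m z) (latticeZoom n (m + 1) z) ≤
      |latticeZoom n (m + 1) z - latticeZoom n m z| := fun m => by
    rw [Real.dist_eq, abs_sub_comm]
  obtain ⟨Lim, hLim⟩ := cauchySeq_tendsto_of_complete
    (cauchySeq_of_dist_le_of_summable _ hdist (h n z hzinj))
  refine ⟨Lim, hLim.congr fun m => ?_⟩
  rw [← rescaledCorrelator_intMesh y z hz m, one_div]

/-- The power-rate form: `|Z(m+1; z) − Z(m; z)| ≤ B · m^{-(1+θ)}` for `m ≥ 1` (`θ > 0`) gives the crux. [cite: DuminilCopinICM2022, §8.4 p. 29] -/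
theorem ExistsScaleCovariantLimit_of_intMeshRate
    (h : ∀ (n : ℕ) (z : Fin n → Site 3), Function.Injective z → ∃ θ : ℝ, 0 < θ ∧ ∃ B : ℝ, ∀ m : ℕ, 1 ≤ m →
      |latticeZoom n (m + 1) z - latticeZoom n m z| ≤ B * (m : ℝ) ^ (-(1 + θ))) :
    Summit.CriticalPhenomena.Ising3DConformalLimit.Theses.HyperoctahedralRP.ExistsScaleCovariantLimit := by
  refine ExistsScaleCovariantLimit_of_summableIntMeshDifferences fun n z hz => ?_
  obtain ⟨θ, hθ, B, hB⟩ := h n z hz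
  -- compare, from `m = 1` on, with the summable `B · m^{-(1+θ)}`; the term `m = 0` is a finite modification
  have hs : Summable fun m : ℕ => B * ((m + 1 : ℕ) : ℝ) ^ (-(1 + θ)) := by
    have h1 : Summable fun m : ℕ => (m : ℝ) ^ (-(1 + θ)) :=
      Real.summable_nat_rpow.2 (by linarith)
    exact ((summable_nat_add_iff 1).2 h1).mul_left B
  refine (summable_nat_add_iff 1).1 ?_
  refine Summable.of_nonneg_of_le (fun m => abs_nonneg _) (fun m => ?_) hs
  exact hB (m + 1) (Nat.le_add_left 1 m)

end Summit.CriticalPhenomena.Ising3DConformalLimit.Cruxes.ExistsScaleCovariantLimit.DecimationHomotopyRate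

end
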